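import Summits.CriticalPhenomena.PercolationContinuityZ3.Theorems.PercNearOneGluingNoHeavyLowerTailThreePointProductFormFibreAntithetic
import HarnessLib

/-!
# The product form `#bad² ≤ #P1·#P2` in the fibre language: THE TWO-TERMINAL INTERFACE AND THE FLAT-FREE FORM OF `w`
# (Sahi programme, prover prim-sahi-p2 gen 55)

Support file (`--supports stmt-CriticalPhenomena-4575`, helper); companion of `…ThreePointProductFormFibreTerminalNetwork` (reduction R3) and of the
TWO-TERMINAL SUBSTITUTION THEOREM of the memo `run/shared/lean/prim/prim-sahi/FROM-prim-sahi-p2-gen55-REDUCTIONS.md` §0(0), §3: a sub-multigraph `N`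
meeting the rest in two ports and containing no terminal is, for `(#bad, #P1, #P2)`, the exact mixture
`A·[contract] + (Cn − A)·[one edge] + (Dn − Cn + A)·[delete]`, whose weights are the ANTITHETIC CLASS SIZES of the two-terminal network
`(N; x, y)`: `Cn = #{x ↔ y}`, `Dn = #{x ↮ y}`, `A = #{x ↔ y in z and in z̄}`.  What makes the mixture linear is that every after-the-flat count the
three events ask of `N` is one of these class sizes.  This file proves the two of those identities that are single flats (the flat `♭ₓz =
clusterFlip ends x z̄` of `…ThreePointCPIClusterSwapDefs`), as corollaries of `card_filter_flat_eq_card_filter_compl` (`…FibreAntithetic`):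
* **`card_virtual_eq_card_conn_not_compl`** [this work] — `V := #{x ↮ y in z, x ↔ y in ♭ₓz} = #{x ↔ y in w, x ↮ y in w̄}` (`= Cn − A`);
* **`card_conn_flat_eq_card_ambi`** [this work] — `#{x ↔ y in z and in ♭ₓz} = #{x ↔ y in w and in w̄} = A`;
* `card_virtual_add_card_ambi` [this work] — hence `V + A = Cn` (the gen-54 two-point facts `V ≤ Cn`, `V ≤ Dn` are its shadow);
* **`card_wt_eq_card_sa_compl`** [this work] — the FLAT-FREE form of the new count of R3: `w = #{a ↔ s, a ↮ c in z, s ↔ c in ♭ₐz}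
  = #{a ↔ s, a ↮ c in z, s ↔ c in z̄}` (so the seven new census inequalities of the memo §0(5) are statements about one two-colouring).
The third identity of the interface theorem (`V^{xy} = Cn − A`, flip around `C_x ∪ C_y`) needs a flip at two vertices and is not here.
Standard axioms, no sorries, no named facts, no definitions.  [folklore] (bijection counting); [cite: Gladkov2024, Conjecture 10.1 (p. 18),
arXiv:2408.08457] for CONJECTURE (P).
-/

namespace Summit.CriticalPhenomena.PercolationContinuityZ3.Theorems.ProductFormFibre

open Finset Literature.Probability.Percolation
open Summit.CriticalPhenomena.PercolationContinuityZ3.Theorems.ThreePointCPIClusterSwap (clusterFlip)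

variable {V α : Type*} [Fintype α] [DecidableEq α]

section TwoTerminal

variable (ends : α → Sym2 V) (x y : V)

open Classical in
/-- **`V = #{x ↔ y in w, x ↮ y in w̄}`**: the configurations in which `x, y` are separated but joined after the flat at `x` are equinumerous
with those in which `x, y` are joined but separated in the complement (bijection `z ↦ ♭ₓz`). [this work] -/
theorem card_virtual_eq_card_conn_not_compl :
    (univ.filter fun z : α → Bool => ¬ (openGraph (labelledOpen ends z)).Reachable x y ∧
        (openGraph (labelledOpen ends (clusterFlip ends x fun l => !z l))).Reachable x y).card =
    (univ.filter fun w : α → Bool => (openGraph (labelledOpen ends w)).Reachable x y ∧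
        ¬ (openGraph (labelledOpen ends fun l => !w l)).Reachable x y).card :=
  card_filter_flat_eq_card_filter_compl ends x
    (fun z => ¬ (openGraph (labelledOpen ends z)).Reachable x y)
    (fun z => (openGraph (labelledOpen ends z)).Reachable x y)
    (fun _ _ h => not_congr (h y))

open Classical in
/-- **`#{x ↔ y in z and in ♭ₓz} = A = #{x ↔ y in w and in w̄}`** (the ambi-connected count). [this work] -/
theorem card_conn_flat_eq_card_ambi :
    (univ.filter fun z : α → Bool => (openGraph (labelledOpen ends z)).Reachable x y ∧
        (openGraph (labelledOpen ends (clusterFlip ends x fun l => !z l))).Reachable x y).card =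
    (univ.filter fun w : α → Bool => (openGraph (labelledOpen ends w)).Reachable x y ∧
        (openGraph (labelledOpen ends fun l => !w l)).Reachable x y).card :=
  card_filter_flat_eq_card_filter_compl ends x
    (fun z => (openGraph (labelledOpen ends z)).Reachable x y)
    (fun z => (openGraph (labelledOpen ends z)).Reachable x y)
    (fun _ _ h => h y)

open Classical in
/-- **The two-terminal interface identity `V + A = Cn`**: `#{x ↮ y in z, x ↔ y in ♭ₓz} + #{x ↔ y in w and in w̄} = #{x ↔ y}`. [this work] -/
theorem card_virtual_add_card_ambi :
    (univ.filter fun z : α → Bool => ¬ (openGraph (labelledOpen ends z)).Reachable x y ∧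
        (openGraph (labelledOpen ends (clusterFlip ends x fun l => !z l))).Reachable x y).card +
    (univ.filter fun w : α → Bool => (openGraph (labelledOpen ends w)).Reachable x y ∧
        (openGraph (labelledOpen ends fun l => !w l)).Reachable x y).card =
    (univ.filter fun w : α → Bool => (openGraph (labelledOpen ends w)).Reachable x y).card := by
  rw [card_virtual_eq_card_conn_not_compl ends x y]
  have h := Finset.card_filter_add_card_filter_not
    (s := univ.filter fun w : α → Bool => (openGraph (labelledOpen ends w)).Reachable x y)
    (fun w : α → Bool => ¬ (openGraph (labelledOpen ends fun l => !w l)).Reachable x y)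
  rw [Finset.filter_filter, Finset.filter_filter] at h
  simp only [not_not] at h
  exact h

end TwoTerminal

section FlatFreeW

variable (ends : α → Sym2 V) (a s c : V)

open Classical in
/-- **THE FLAT-FREE FORM OF `w`.**  The count `w = #{z : a ↔ s, a ↮ c in z, s ↔ c in ♭ₐz}` of reduction R3 (`…FibreTerminalNetwork`, event `Wt`
with `u` for `s`) equals `#{z : a ↔ s, a ↮ c in z, s ↔ c in z̄}`: red joins `a` to `s` but not to `c`, blue joins `s` to `c`.  (`P1` is an
apex-cluster class, so `card_filter_flat_eq_card_filter_compl` applies; then swap the configuration and its complement.) [this work] -/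
theorem card_wt_eq_card_sa_compl :
    (univ.filter fun z : α → Bool =>
        ((openGraph (labelledOpen ends z)).Reachable a s ∧ ¬ (openGraph (labelledOpen ends z)).Reachable a c) ∧
        (openGraph (labelledOpen ends (clusterFlip ends a fun l => !z l))).Reachable s c).card =
    (univ.filter fun z : α → Bool =>
        ((openGraph (labelledOpen ends z)).Reachable a s ∧ ¬ (openGraph (labelledOpen ends z)).Reachable a c) ∧
        (openGraph (labelledOpen ends fun l => !z l)).Reachable s c).card := by
  rw [card_filter_flat_eq_card_filter_compl ends a
    (fun z => (openGraph (labelledOpen ends z)).Reachable a s ∧ ¬ (openGraph (labelledOpen ends z)).Reachable a c)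
    (fun z => (openGraph (labelledOpen ends z)).Reachable s c)
    (fun _ _ h => and_congr (h s) (not_congr (h c)))]
  exact card_filter_compl_swap (fun w => (openGraph (labelledOpen ends w)).Reachable s c)
    (fun w => (openGraph (labelledOpen ends w)).Reachable a s ∧ ¬ (openGraph (labelledOpen ends w)).Reachable a c)

end FlatFreeW

end Summit.CriticalPhenomena.PercolationContinuityZ3.Theorems.ProductFormFibre
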